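import Literature.AlgebraicGeometry.ModuliOfAbelianVarieties.SiegelFamilyEllipticCurveDegreeHumbert
import Literature.Geometry.Kaehler.ComplexTorusRefinedHumbertInvariant
import HarnessLib

/-!
# Kani's refined Humbert invariant on the Siegel family: `q_{(X_Z, θ_Z)}(D) = Δ(q(D))` is Humbert's invariant of
# the singular relation of `D`, and `H_Δ(𝔥₂) = {Z : q_{(X_Z,θ_Z)} represents Δ on NS(X_Z)}` (Kani 1994; B–W 2003)

Layer `Literature/AlgebraicGeometry/ModuliOfAbelianVarieties`, namespace `…SiegelModuli`; lane `lit-hodgefound`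
(Track 2 foundations library, Layer A4), row **A4-62** (seat skel-4), FILE 2 — the junction of FILE 1
(`Geometry/Kaehler/ComplexTorusRefinedHumbertInvariant`: Kani's form `q̃_{(A,θ)}(D) = (D·θ)² − 2(D·D)` of a
principally polarised abelian surface at torus level, invariant under `D ↦ D + mθ`, POSITIVE DEFINITE on
`NS(A)/ℤθ`) with rows A4-59/A4-60 (`SiegelFamilyHumbertSurfaces`, `…Symplectic`, `…SquareInvariant`: Humbert's
singular relations `q = (a, b, c, d, e) ∈ ℤ⁵` of `Z ∈ 𝔥₂`, their invariant `Δ(q) = b² − 4ac − 4de`, the loci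
`H_q ⊂ 𝔥₂` and `H_Δ(𝔥₂) = ⋃ {H_q : q ≠ 0, Δ(q) = Δ}`, the identity `Δ(q(N)) = (N₁₃ + N₂₄)² + 4 Pf(N)`) and
A4-61‴ (`SiegelFamilyEllipticCurveDegreeHumbert`: `∫_X E_{Z,ℂ} ∧ E′_ℂ = −sign(e₀)(E′₁₃ + E′₂₄)`).

## Sources, VERBATIM

E. Kani, *Curves of genus 2 on abelian surfaces* (Queen's preprint) [KaniCurvesGenus2AbelianSurfaces], §2 (11)
(chunk p0005 of `galaxy-pdf--7858033051244592000`):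

> "(11) `q̃_{(A,θ)}(D) = β_A(D,θ)² − 4q_A(D) = (D.θ)² − 2(D.D)`, for `D ∈ NS(A)`. It is easy to see (see [K1])
> that this defines a positive-definite quadratic form `q_{(A,θ)}` on the quotient space `NS(A,θ) := NS(A)/ℤθ`.
> […] the quadratic module `(NS(A,θ), q_{(A,θ)})` is called the *refined Humbert invariant* of the principally
> polarized abelian surface `(A,θ)`; cf. [K4]."

([K1] = E. Kani, *Elliptic curves on abelian surfaces*, Manuscripta Math. **84** (1994) 199–223
[Kani1994EllipticCurvesAbelianSurfaces].) H. Kır, *The classification of the refined Humbert invariant for curves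
of genus 2*, [Kir2025RefinedHumbertClassification] §3 (p0007 L3–L11): "the refined Humbert invariant which was
introduced by Kani [kani1994elliptic], [MJ] […] `q_{(A,θ)}(D) = (D.θ)² − 2(D.D)`, for `D ∈ NS(A)`, where `(.)`
denotes the intersection number of divisors. By [kani1994elliptic], `q_{(A,θ)}` defines a positive definite
quadratic form on the quotient group `NS(A,θ) := NS(A)/ℤθ`." The Humbert surfaces through `q_{(A,θ)}`
([MJ] = E. Kani, *The moduli spaces of Jacobians isomorphic to a product of two elliptic curves*, Collect. Math.
67 (2016) [Kani2016ModuliJacobiansProductElliptic], quoted from arXiv:2602.14319, §6 (6.1), p0025): "The refined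
Humbert invariant is an algebraic generalization of the (usual) Humbert invariant, and it also provides an
algebraic description of the Humbert surfaces due to Kani [MJ]: […] `H_N = {⟨A,θ⟩ ∈ 𝒜₂(K) : q_{(A,θ)} → N}`"
(there `q → N` means: `q` PRIMITIVELY represents `N`, p0007 L61 of the same paper).

Ch. Birkenhake, H. Wilhelm, *Humbert surfaces and the Kummer plane*, Trans. AMS **355** (2003)
[BirkenhakeWilhelm2003], §1 (∗) (p. 1819): `H_Δ` is "the image in `𝒜₂` of the zero locus in `ℌ₂` of any
equation of the form (∗) `az₁ + bz₂ + cz₃ + d(z₂² − z₁z₃) + e = 0` with integers `a, b, c, d` and `e` satisfying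
`Δ = b² − 4ac − 4de`"; §4 eq. (11) and Prop. 4.3 (`Disc = Tr² − 4N`).

## Statement formalized (torus level: `Z ∈ 𝔥₂`, `X_Z = ℂ²/(Z 1₂)ℤ⁴` with period isomorphism `Φ_Z = prinPeriod Z`,
lattice basis `(x₁, x₂, y₁, y₂) = (Ze₁, Ze₂, e₁, e₂)` enumerated by `stdIdx`, principal Riemann form `θ_Z = E_Z = prinForm Z`)

* §1 **`(X_Z, E_Z)` is principally polarised** (`isPrincipalPolarization_prinForm`: the Gram matrix `−J` of
  `E_Z` is unimodular — Mathlib's `SymplecticGroup.det_eq_one`), `(θ_Z²) = ∫_X E_{Z,ℂ} ∧ E_{Z,ℂ} = 2`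
  (`torusIntegral_prinForm_wedge_prinForm`), whence **the orientation sign of `(x₁, x₂, y₁, y₂)` for the complex
  orientation is `−1`** (`orientationSign_prinPeriod_stdIdx`) and A4-61‴'s formula without its sign:
  `∫_X E_{Z,ℂ} ∧ E′_ℂ = E′₁₃ + E′₂₄` (`torusIntegral_prinForm_wedge_ofRealForm_eq`).
* §2 **The intersection form of `X_Z` in lattice coordinates**: for real `2`-forms `η, η′` with Gram matrices
  `G = (η(λ_a, λ_b))`, `G′`, `(D·D′) = ∫_X η_ℂ ∧ η′_ℂ = −(G₁₂G′₃₄ − G₁₃G′₂₄ + G₁₄G′₂₃ + G₃₄G′₁₂ − G₂₄G′₁₃ + G₂₃G′₁₄)`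
  (`torusIntegral_ofRealForm_wedge_ofRealForm`), `(D·D) = −2 Pf(G)` (`torusIntegral_ofRealForm_wedge_self`),
  `(D·θ_Z) = G₁₃ + G₂₄` (`re_torusIntegral_wedge_prinForm`).
* §3 **KANI = HUMBERT**: for EVERY real `2`-form `η` on `ℂ²`,
  **`q̃_{θ_Z}(η) = (η·θ_Z)² − 2(η·η) = (G₁₃ + G₂₄)² + 4 Pf(G) = Δ(q(G))`** — Kani's refined Humbert value of a class
  is the Humbert invariant `b² − 4ac − 4de` of its coefficient vector `q(G) = (G₂₃, G₂₄ − G₁₃, −G₁₄, −G₃₄, G₁₂)`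
  (`refinedHumbert_prinForm_eq_humbertInvariant`; for `D ∈ NS(X_Z)` with integer Humbert vector `q`:
  `q̃_{θ_Z}(D) = Δ(q)`, `refinedHumbert_prinForm_eq_of_humbertVector_eq`).
* §4 **`H_Δ(𝔥₂)` through the refined Humbert invariant**: for `Δ ≠ 0`,
  **`Z ∈ H_Δ(𝔥₂) ⟺ ∃ D ∈ NS(X_Z), q̃_{(X_Z,θ_Z)}(D) = Δ`**
  (`mem_humbertLocusOfInvariant_iff_exists_isNSForm_refinedHumbert_eq`), and for every `Δ`,
  `Z ∈ H_Δ(𝔥₂) ⟺ ∃ D ∈ NS(X_Z) ∖ ℤθ_Z, q̃(D) = Δ` (`mem_humbertLocusOfInvariant_iff_exists_isNSForm`; for `Δ = 0`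
  both sides are empty: B–W Prop. 4.7 `H_0(𝔥₂) = ∅` on the left, Kani's positive definiteness of FILE 1 on the
  right).
* §5 **Elliptic curves**: for an elliptic curve `Y ⊂ X_Z` with class `[Y] = D_ℂ`, `D ∈ NS(X_Z)`:
  `q̃_{θ_Z}(D) = (E_Z(Φλ′₀, Φλ′₁))² = (deg_{θ_Z} Y)²` (`refinedHumbert_prinForm_eq_degree_sq`), and with A4-61‴:
  `∃ δ > 0, deg Y = δ ∧ q̃(D) = δ² ∧ Z ∈ H_{δ²}(𝔥₂)` (`exists_isNSForm_refinedHumbert_eq_degree_sq`); validation on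
  the diagonal: `z₁₂ = 0 ⟹ ∃ D ∈ NS(X_Z), q̃(D) = 1` (`exists_isNSForm_refinedHumbert_eq_one_of_apply_eq_zero`).

## Scope (NOT formalised here)

Kani's own `H_N` is defined with PRIMITIVE representation (`q_{(A,θ)} → N`: `N = q̃(D̄)` for a primitive `D̄` of
`NS(A)/ℤθ`), i.e. through primitive singular relations; the tree's `humbertLocusOfInvariant Δ` (row A4-59, B–W
§1) allows every non-zero integer relation (so that `H_Δ ⊆ H_{m²Δ}`, B–W p. 1830), and §4 characterises THAT locus
("`q_{(X_Z,θ_Z)}` represents `Δ`", not necessarily primitively). The quotient `𝒜₂ = Sp₄(ℤ)\𝔥₂` is not formed.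

## References

* [KaniCurvesGenus2AbelianSurfaces] E. Kani, *Curves of genus 2 on abelian surfaces*, preprint (Queen's Univ.),
  §2 (10)–(11), Lemma 12.
* [Kani1994EllipticCurvesAbelianSurfaces] E. Kani, *Elliptic curves on abelian surfaces*, Manuscripta Math. 84
  (1994) 199–223.
* [Kani2016ModuliJacobiansProductElliptic] E. Kani, *The moduli spaces of Jacobians isomorphic to a product of two
  elliptic curves*, Collect. Math. 67 (2016) 21–54 (the Humbert surface `H_N` via `q_{(A,θ)}`).
* [Kir2025RefinedHumbertClassification] H. Kır, *The classification of the refined Humbert invariant for curves of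
  genus 2*, §3.
* [BirkenhakeWilhelm2003] Ch. Birkenhake, H. Wilhelm, *Humbert surfaces and the Kummer plane*, Trans. Amer. Math.
  Soc. 355 (2003) 1819–1841 — §1 (∗), §4 (11), Prop. 4.3, Prop. 4.7, Prop. 4.8.
* [Lange2023AbelianVarietiesComplex] H. Lange, *Abelian Varieties over the Complex Numbers* (2023), §2.1.1
  (principal polarisation), §3.1.1 Prop. 3.1.1 and (3.1) (`E_Z`), §6.2.4 (`∫_X`), §5.1.5 Exercise (17) (Pfaffian).
-/

noncomputable section

set_option maxSynthPendingDepth 3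

open Module Function Complex Matrix Set Sum

namespace Literature.AlgebraicGeometry.ModuliOfAbelianVarieties

namespace SiegelModuli

open Literature.NumberTheory.Automorphic (siegelUpperHalfSpace)
open Literature.NumberTheory.ModularForms.SiegelUpperHalfSpace
open Literature.Geometry.Kaehler Literature.Geometry.Kaehler.ComplexTorus
open Literature.Analysis.Complex Literature.LinearAlgebra.Alternating

/-! ## §1 `(X_Z, E_Z)` is principally polarised; `(θ_Z²) = 2`; the orientation sign of `(x₁, x₂, y₁, y₂)` -/

/-- **`E_Z` is a PRINCIPAL polarisation of `X_Z`** for every `Z ∈ 𝔥_g`: it is a Riemann form (row A4-56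
`isRiemannForm_prinForm`) whose Gram matrix on the lattice basis `(Ze_i, e_i)` is `−J = (0 1; −1 0)` (row A4-60
`latticeGram_prinForm`), of determinant `1` (Mathlib's `SymplecticGroup.det_eq_one`): type `(1, …, 1)`.
[cite: Lange2023AbelianVarietiesComplex, §2.1.1 ("principal … of type `(1, …, 1)`") and §3.1.1 Prop. 3.1.1 (p0157–p0158)] -/
theorem isPrincipalPolarization_prinForm {g : ℕ} (Z : siegelUpperHalfSpace g) :
    IsPrincipalPolarization (prinPeriod Z) (prinForm Z) where
  isRiemannForm := isRiemannForm_prinForm Z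
  det_latticeGram := by
    rw [latticeGram_prinForm]
    exact SymplecticGroup.det_eq_one (SymplecticGroup.neg_mem (SymplecticGroup.J_mem (Fin g) ℝ))

variable (Z : siegelUpperHalfSpace 2)

/-- The lattice frame of `X_Z` in the enumeration `stdIdx = (x₁, x₂, y₁, y₂)`. [folklore] -/
private theorem latticeFrame_stdIdx :
    latticeFrame (prinPeriod Z) ⇑stdIdx =
      ![prinPeriod Z (Pi.single (inl 0) 1), prinPeriod Z (Pi.single (inl 1) 1),
        prinPeriod Z (Pi.single (inr 0) 1), prinPeriod Z (Pi.single (inr 1) 1)] := by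
  funext j
  fin_cases j <;> rfl

/-- **`(θ_Z²) = ∫_X E_{Z,ℂ} ∧ E_{Z,ℂ} = 2`** (Riemann–Roch for the principal polarisation of the surface `X_Z`;
FILE 1 `IsPrincipalPolarization.torusIntegral_wedge_self_eq_two`).
[cite: KaniCurvesGenus2AbelianSurfaces, §2 Lemma 12 (proof: "`β_A(θ,θ) = 2q_A(θ) = 2`") (chunk p0008)] [cite: Lange2023AbelianVarietiesComplex, §1.7.2 Thm. 1.7.3] -/
theorem torusIntegral_prinForm_wedge_prinForm :
    ComplexTorus.torusIntegral (prinPeriod Z) stdIdx ((ofRealForm (prinForm Z)).wedge (ofRealForm (prinForm Z))) = 2 :=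
  (isPrincipalPolarization_prinForm Z).torusIntegral_wedge_self_eq_two (prinPeriod Z) stdIdx

/-- **The real frame `(x₁, x₂, y₁, y₂) = (Ze₁, Ze₂, e₁, e₂)` of `ℂ²` is NEGATIVELY oriented for the complex
orientation**: `sign(stdIdx) = −1` — A4-61‴'s `∫_X E_{Z,ℂ} ∧ E_{Z,ℂ} = −sign · ((−J)₁₃ + (−J)₂₄) = −2·sign` against
`(θ_Z²) = 2`. [cite: Lange2023AbelianVarietiesComplex, §6.2.4 p. 310 (`∫_X`, orientation) and §3.1.1 (3.1)] -/
theorem orientationSign_prinPeriod_stdIdx : orientationSign (prinPeriod Z) ⇑stdIdx = -1 := by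
  have h1 := torusIntegral_prinForm_wedge_ofRealForm Z (prinForm Z)
  rw [torusIntegral_prinForm_wedge_prinForm Z, latticeGram_prinForm] at h1
  rcases orientationSign_eq_or (prinPeriod Z) ⇑stdIdx with h | h
  · exfalso
    rw [h] at h1
    simp [Matrix.J] at h1
    norm_num at h1
  · exact h

/-- **`∫_X E_{Z,ℂ} ∧ E′_ℂ = E′(λ_{x₁}, λ_{y₁}) + E′(λ_{x₂}, λ_{y₂})`** for every real `2`-form `E′` (A4-61‴
`torusIntegral_prinForm_wedge_ofRealForm` with the sign `−1` of `stdIdx` inserted).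
[cite: Lange2023AbelianVarietiesComplex, §6.2.4 p. 310 (`∫_X`)] [cite: BirkenhakeWilhelm2003, §4 proof of Prop. 4.8 (p. 1830)] -/
theorem torusIntegral_prinForm_wedge_ofRealForm_eq (η : (Fin 2 → ℂ) [⋀^Fin 2]→L[ℝ] ℝ) :
    ComplexTorus.torusIntegral (prinPeriod Z) stdIdx ((ofRealForm (prinForm Z)).wedge (ofRealForm η)) =
      ((latticeGram (prinPeriod Z) η (inl 0) (inr 0) + latticeGram (prinPeriod Z) η (inl 1) (inr 1) : ℝ) : ℂ) := by
  rw [torusIntegral_prinForm_wedge_ofRealForm Z η, orientationSign_prinPeriod_stdIdx Z]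
  push_cast
  ring

/-! ## §2 The intersection form of `X_Z` in lattice coordinates -/

/-- **`(D·D′) = ∫_X η_ℂ ∧ η′_ℂ` in the Gram matrices `G = (η(λ_a, λ_b))`, `G′`**:
`∫_X η_ℂ ∧ η′_ℂ = −(G₁₂G′₃₄ − G₁₃G′₂₄ + G₁₄G′₂₃ + G₃₄G′₁₂ − G₂₄G′₁₃ + G₂₃G′₁₄)` (the six `(2,2)`-shuffles, Warner
2.10(b), on the negatively oriented frame `(x₁, x₂, y₁, y₂)`).
[cite: Lange2023AbelianVarietiesComplex, §6.2.4 p. 310 (`∫_X`) and §5.1.5 Exercise (17)(b) (p. 254)] [cite: WarnerGTM94, 2.10(b)] -/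
theorem torusIntegral_ofRealForm_wedge_ofRealForm (η η' : (Fin 2 → ℂ) [⋀^Fin 2]→L[ℝ] ℝ) :
    ComplexTorus.torusIntegral (prinPeriod Z) stdIdx ((ofRealForm η).wedge (ofRealForm η')) =
      ((-(latticeGram (prinPeriod Z) η (inl 0) (inl 1) * latticeGram (prinPeriod Z) η' (inr 0) (inr 1)
          - latticeGram (prinPeriod Z) η (inl 0) (inr 0) * latticeGram (prinPeriod Z) η' (inl 1) (inr 1)
          + latticeGram (prinPeriod Z) η (inl 0) (inr 1) * latticeGram (prinPeriod Z) η' (inl 1) (inr 0)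
          + latticeGram (prinPeriod Z) η (inr 0) (inr 1) * latticeGram (prinPeriod Z) η' (inl 0) (inl 1)
          - latticeGram (prinPeriod Z) η (inl 1) (inr 1) * latticeGram (prinPeriod Z) η' (inl 0) (inr 0)
          + latticeGram (prinPeriod Z) η (inl 1) (inr 0) * latticeGram (prinPeriod Z) η' (inl 0) (inr 1)) : ℝ) : ℂ) := by
  rw [ComplexTorus.torusIntegral, orientationSign_prinPeriod_stdIdx, ← ofRealForm_wedge, ofRealForm_apply,
    latticeFrame_stdIdx, ContinuousAlternatingMap.wedge_apply_two_two]
  simp only [← latticeGram_apply]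
  push_cast
  ring

/-- **`(D·D) = ∫_X η_ℂ ∧ η_ℂ = −2 Pf(G) = −2 (G₁₂G₃₄ − G₁₃G₂₄ + G₁₄G₂₃)`** (twice the Pfaffian of Lange's
Exercise 5.1.5 (17)(b), with the sign of the orientation).
[cite: Lange2023AbelianVarietiesComplex, §5.1.5 Exercise (17)(b) (p. 254) and §6.2.4 p. 310] -/
theorem torusIntegral_ofRealForm_wedge_self (η : (Fin 2 → ℂ) [⋀^Fin 2]→L[ℝ] ℝ) :
    ComplexTorus.torusIntegral (prinPeriod Z) stdIdx ((ofRealForm η).wedge (ofRealForm η)) =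
      ((-(2 * (latticeGram (prinPeriod Z) η (inl 0) (inl 1) * latticeGram (prinPeriod Z) η (inr 0) (inr 1)
          - latticeGram (prinPeriod Z) η (inl 0) (inr 0) * latticeGram (prinPeriod Z) η (inl 1) (inr 1)
          + latticeGram (prinPeriod Z) η (inl 0) (inr 1) * latticeGram (prinPeriod Z) η (inl 1) (inr 0))) : ℝ) : ℂ) := by
  rw [torusIntegral_ofRealForm_wedge_ofRealForm]
  push_cast
  ring

/-- **`(D·θ_Z) = Re ∫_X η_ℂ ∧ E_{Z,ℂ} = G₁₃ + G₂₄ = η(λ_{x₁}, λ_{y₁}) + η(λ_{x₂}, λ_{y₂})`** — the degree of a class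
with respect to the principal polarisation, in lattice coordinates.
[cite: BirkenhakeWilhelm2003, §4 proof of Prop. 4.8 (p. 1830: "`deg L₀|E₁ = δ`")] [cite: Lange2023AbelianVarietiesComplex, §6.2.4 p. 310] -/
theorem re_torusIntegral_wedge_prinForm (η : (Fin 2 → ℂ) [⋀^Fin 2]→L[ℝ] ℝ) :
    (ComplexTorus.torusIntegral (prinPeriod Z) stdIdx ((ofRealForm η).wedge (ofRealForm (prinForm Z)))).re =
      latticeGram (prinPeriod Z) η (inl 0) (inr 0) + latticeGram (prinPeriod Z) η (inl 1) (inr 1) := by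
  rw [wedge_comm_two_two_complex, torusIntegral_prinForm_wedge_ofRealForm_eq, Complex.ofReal_re]

/-- `(D·D)` on real parts: `Re ∫_X η_ℂ ∧ η_ℂ = −2 Pf(G)`. [cite: Lange2023AbelianVarietiesComplex, §5.1.5 Exercise (17)(b) (p. 254)] -/
theorem re_torusIntegral_wedge_self (η : (Fin 2 → ℂ) [⋀^Fin 2]→L[ℝ] ℝ) :
    (ComplexTorus.torusIntegral (prinPeriod Z) stdIdx ((ofRealForm η).wedge (ofRealForm η))).re =
      -(2 * (latticeGram (prinPeriod Z) η (inl 0) (inl 1) * latticeGram (prinPeriod Z) η (inr 0) (inr 1)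
          - latticeGram (prinPeriod Z) η (inl 0) (inr 0) * latticeGram (prinPeriod Z) η (inl 1) (inr 1)
          + latticeGram (prinPeriod Z) η (inl 0) (inr 1) * latticeGram (prinPeriod Z) η (inl 1) (inr 0))) := by
  rw [torusIntegral_ofRealForm_wedge_self, Complex.ofReal_re]

/-! ## §3 Kani = Humbert: `q̃_{θ_Z}(η) = Δ(q(G_η))` -/

/-- FILE 1's definition unfolded at `(Φ_Z, stdIdx, θ_Z)`. [cite: KaniCurvesGenus2AbelianSurfaces, §2 (11) (chunk p0005)] -/
private theorem refinedHumbert_prinForm_unfold (η : (Fin 2 → ℂ) [⋀^Fin 2]→L[ℝ] ℝ) :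
    refinedHumbert (prinPeriod Z) stdIdx (prinForm Z) η =
      (ComplexTorus.torusIntegral (prinPeriod Z) stdIdx ((ofRealForm η).wedge (ofRealForm (prinForm Z)))).re ^ 2 -
        2 * (ComplexTorus.torusIntegral (prinPeriod Z) stdIdx ((ofRealForm η).wedge (ofRealForm η))).re :=
  refinedHumbert_eq (prinPeriod Z) stdIdx (prinForm Z) η

/-- **KANI'S REFINED HUMBERT VALUE IS HUMBERT'S INVARIANT `Δ` on the Siegel family.** For every real `2`-form `η`
on `ℂ²` with Gram matrix `G = (η(λ_a, λ_b))` on the lattice basis `(x₁, x₂, y₁, y₂)` of `X_Z`: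
**`q̃_{θ_Z}(η) = (η·θ_Z)² − 2(η·η) = (G₁₃ + G₂₄)² + 4 Pf(G) = Δ(q(G)) = b² − 4ac − 4de`**, where
`q(G) = (a, b, c, d, e) = (G₂₃, G₂₄ − G₁₃, −G₁₄, −G₃₄, G₁₂)` is the coefficient vector of the singular relation
cut out by `η` (row A4-59 `humbertVector`, A4-60 `humbertInvariant_humbertVectorOfGram_eq_sq_add`). This is the
dictionary "refined Humbert invariant ↔ (usual) Humbert invariant" («an algebraic generalization of the (usual)
Humbert invariant»; B–W (11): for the class of a curve `C`, `Δ = (C·Θ)² − 2(C²)`).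
[cite: KaniCurvesGenus2AbelianSurfaces, §2 (11) (chunk p0005)] [cite: Kani1994EllipticCurvesAbelianSurfaces] [cite: Kani2016ModuliJacobiansProductElliptic, (`H_N` via `q_{(A,θ)}`, quoted in arXiv:2602.14319 (6.1), p0025)] [cite: BirkenhakeWilhelm2003, §4 eq. (11) and Prop. 4.3 (pp. 1827–1830)] -/
theorem refinedHumbert_prinForm_eq_humbertInvariant (η : (Fin 2 → ℂ) [⋀^Fin 2]→L[ℝ] ℝ) :
    refinedHumbert (prinPeriod Z) stdIdx (prinForm Z) η =
      humbertInvariant (humbertVectorOfGram (latticeGram (prinPeriod Z) η)) := by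
  rw [refinedHumbert_prinForm_unfold, re_torusIntegral_wedge_prinForm, re_torusIntegral_wedge_self,
    humbertInvariant_humbertVectorOfGram_eq_sq_add]
  ring

/-- The same identity read in `H²(X_Z, ℂ)`: `q̃_{θ_Z}(η) = Δ(q(η_ℂ ∘ Φ_Z))` with row A4-59's complex Humbert
vector of the flat section `η_ℂ ∘ Φ_Z`. [cite: KaniCurvesGenus2AbelianSurfaces, §2 (11) (chunk p0005)] [cite: BirkenhakeWilhelm2003, §4 eq. (11) (p. 1830)] -/
theorem ofReal_refinedHumbert_prinForm_eq (η : (Fin 2 → ℂ) [⋀^Fin 2]→L[ℝ] ℝ) :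
    ((refinedHumbert (prinPeriod Z) stdIdx (prinForm Z) η : ℝ) : ℂ) =
      humbertInvariant (humbertVector (latticeForm Z (ofRealForm η))) := by
  rw [humbertInvariant_humbertVector_eq_sq_add]
  simp only [latCoeff_latticeForm_ofRealForm]
  rw [refinedHumbert_prinForm_eq_humbertInvariant, humbertInvariant_humbertVectorOfGram_eq_sq_add]
  push_cast
  ring

/-- **`q̃_{θ_Z}(D) = Δ(q)` for a class `D` with INTEGER Humbert vector `q ∈ ℤ⁵`** (e.g. `D ∈ NS(X_Z)`, row A4-59
`exists_int_humbertVector_of_mem_integralForms`). [cite: KaniCurvesGenus2AbelianSurfaces, §2 (11) (chunk p0005)] [cite: BirkenhakeWilhelm2003, §1 (∗) (p. 1819) and §4 eq. (11)] -/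
theorem refinedHumbert_prinForm_eq_of_humbertVector_eq {η : (Fin 2 → ℂ) [⋀^Fin 2]→L[ℝ] ℝ} {q : Fin 5 → ℤ}
    (hq : humbertVector (latticeForm Z (ofRealForm η)) = fun i ↦ (q i : ℂ)) :
    refinedHumbert (prinPeriod Z) stdIdx (prinForm Z) η = humbertInvariant q := by
  have h1 := ofReal_refinedHumbert_prinForm_eq Z η
  have h2 : humbertInvariant (fun i ↦ (q i : ℂ)) = ((humbertInvariant q : ℤ) : ℂ) := by
    have h := map_humbertInvariant (Int.castRingHom ℂ) q
    simp only [eq_intCast, Function.comp_def] at h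
    exact h.symm
  rw [hq, h2] at h1
  exact_mod_cast h1

/-! ## §4 `H_Δ(𝔥₂) = {Z : q_{(X_Z, θ_Z)} represents Δ on NS(X_Z)}` -/

/-- **THE HUMBERT SURFACE OF INVARIANT `Δ` THROUGH KANI'S FORM.** For `Δ ≠ 0` and `Z ∈ 𝔥₂`:
**`Z ∈ H_Δ(𝔥₂)` iff the refined Humbert form `q_{(X_Z, θ_Z)}` REPRESENTS `Δ` on `NS(X_Z)`**, i.e. iff
`q̃_{θ_Z}(D) = (D·θ_Z)² − 2(D·D) = Δ` for some `D ∈ NS(X_Z)` («it also provides an algebraic description of the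
Humbert surfaces due to Kani [MJ]: `H_N = {⟨A,θ⟩ : q_{(A,θ)} → N}`»; here with B–W's `H_Δ = ⋃ {H_q : q ≠ 0,
Δ(q) = Δ}`, representation not required primitive — see the Scope note). (⟹): a non-trivial integer relation
`q` of `Z` with `Δ(q) = Δ` is the Humbert vector of the integral Hodge class `γ_q ∈ NS(X_Z)` (row A4-59
`humbertClass`), and `q̃(γ_q) = Δ(q)` by §3; (⟸): the integer Humbert vector `q(D)` of `D ∈ NS(X_Z)` is a relation
of `Z` (row A4-59 `mem_hodgeClasses_iff_singularRelation_eq_zero`) with `Δ(q(D)) = q̃(D) = Δ ≠ 0`, so `q(D) ≠ 0`.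
[cite: Kani2016ModuliJacobiansProductElliptic, (`H_N = {⟨A,θ⟩ : q_{(A,θ)} → N}`, quoted in arXiv:2602.14319 §6 (6.1), p0025)] [cite: Kani1994EllipticCurvesAbelianSurfaces] [cite: KaniCurvesGenus2AbelianSurfaces, §2 (11) (chunk p0005)] [cite: BirkenhakeWilhelm2003, §1 (∗) (p. 1819)] -/
theorem mem_humbertLocusOfInvariant_iff_exists_isNSForm_refinedHumbert_eq {Δ : ℤ} (hΔ : Δ ≠ 0) :
    Z ∈ humbertLocusOfInvariant Δ ↔
      ∃ η : (Fin 2 → ℂ) [⋀^Fin 2]→L[ℝ] ℝ, IsNSForm (prinPeriod Z) η ∧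
        refinedHumbert (prinPeriod Z) stdIdx (prinForm Z) η = Δ := by
  constructor
  · intro hZ
    obtain ⟨q, -, hqΔ, hZq⟩ := mem_humbertLocusOfInvariant_iff.1 hZ
    have hH : humbertClass Z q ∈ hodgeClasses (prinPeriod Z) 1 :=
      humbertClass_mem_hodgeClasses (mem_humbertLocus_iff.1 hZq)
    have hIH : humbertClass Z q ∈ integralHodgeClasses (prinPeriod Z) 1 :=
      (mem_integralHodgeClasses_iff (prinPeriod Z)).2
        ⟨humbertClass_mem_integralForms Z q, ((mem_hodgeClasses_iff (prinPeriod Z)).1 hH).2⟩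
    obtain ⟨η, hηNS, hηγ⟩ := (mem_integralHodgeClasses_one_iff_exists (prinPeriod Z)).1 hIH
    refine ⟨η, (mem_neronSeveriGroup_iff (prinPeriod Z)).1 hηNS, ?_⟩
    rw [← hqΔ]
    exact refinedHumbert_prinForm_eq_of_humbertVector_eq Z (by rw [hηγ, humbertVector_humbertClass])
  · rintro ⟨η, hη, hqη⟩
    have hγI := ofRealForm_mem_integralForms_two (prinPeriod Z) hη
    have hγH := ofRealForm_mem_hodgeClasses_one (prinPeriod Z) hη
    obtain ⟨q, hq⟩ := exists_int_humbertVector_of_mem_integralForms hγI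
    have hqΔ : humbertInvariant q = Δ := by
      have h := refinedHumbert_prinForm_eq_of_humbertVector_eq Z hq
      rw [hqη] at h
      exact_mod_cast h.symm
    refine mem_humbertLocusOfInvariant_iff.2 ⟨q, ?_, hqΔ, mem_humbertLocus_iff.2 ?_⟩
    · rintro rfl
      apply hΔ
      rw [← hqΔ]
      simp [humbertInvariant]
    · rw [← hq]
      exact (mem_hodgeClasses_iff_singularRelation_eq_zero Z (mem_rationalForms_of_mem_integralForms _ hγI)).1 hγH

/-- **`H_Δ(𝔥₂) = {Z : q_{(X_Z,θ_Z)}(D̄) = Δ for some D̄ ≠ 0 in NS(X_Z)/ℤθ_Z}` for EVERY `Δ ∈ ℤ`.** For `Δ ≠ 0` this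
is the previous theorem (a class with `q̃ ≠ 0` is off `ℤθ`, FILE 1 `refinedHumbert_self`/`_smul_self`); for
`Δ = 0` both sides are empty — `H_0(𝔥₂) = ∅` (row A4-59, B–W Prop. 4.7: a non-trivial relation with a zero in
`𝔥₂` has `Δ > 0`) and, on the right, KANI'S POSITIVE DEFINITENESS `q̃(D) = 0 ⟹ D ∈ ℤθ` (FILE 1
`IsPrincipalPolarization.refinedHumbert_eq_zero_iff_exists_int`, the Hodge index theorem).
[cite: KaniCurvesGenus2AbelianSurfaces, §2 (11) ("positive-definite quadratic form `q_{(A,θ)}` on … `NS(A)/ℤθ`") (chunk p0005)] [cite: Kani1994EllipticCurvesAbelianSurfaces] [cite: BirkenhakeWilhelm2003, §4 Prop. 4.7 (p. 1830)] -/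
theorem mem_humbertLocusOfInvariant_iff_exists_isNSForm (Δ : ℤ) :
    Z ∈ humbertLocusOfInvariant Δ ↔
      ∃ η : (Fin 2 → ℂ) [⋀^Fin 2]→L[ℝ] ℝ, IsNSForm (prinPeriod Z) η ∧ (∀ m : ℤ, η ≠ m • prinForm Z) ∧
        refinedHumbert (prinPeriod Z) stdIdx (prinForm Z) η = Δ := by
  rcases eq_or_ne Δ 0 with rfl | hΔ
  · rw [humbertLocusOfInvariant_eq_empty le_rfl]
    simp only [Set.mem_empty_iff_false, false_iff, not_exists, not_and, Int.cast_zero]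
    intro η hη hne h0
    obtain ⟨m, hm⟩ :=
      ((isPrincipalPolarization_prinForm Z).refinedHumbert_eq_zero_iff_exists_int (prinPeriod Z) stdIdx hη).1 h0
    exact hne m hm
  · rw [mem_humbertLocusOfInvariant_iff_exists_isNSForm_refinedHumbert_eq Z hΔ]
    constructor
    · rintro ⟨η, hη, h⟩
      refine ⟨η, hη, fun m hm ↦ hΔ ?_, h⟩
      have h0 : refinedHumbert (prinPeriod Z) stdIdx (prinForm Z) η = 0 :=
        ((isPrincipalPolarization_prinForm Z).refinedHumbert_eq_zero_iff_exists_int (prinPeriod Z) stdIdx hη).2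
          ⟨m, hm⟩
      rw [h0] at h
      exact_mod_cast h.symm
    · rintro ⟨η, hη, -, h⟩
      exact ⟨η, hη, h⟩

/-- **Kani's positive definiteness recovers B–W Prop. 4.7 on the `NS` side**: every `D ∈ NS(X_Z)` has
`q̃_{θ_Z}(D) ≥ 0`, `= 0` iff `D ∈ ℤθ_Z`; in particular the Humbert invariant `Δ(q(D))` of the (integer) singular
relation of a Néron–Severi class of `X_Z` is `≥ 0` and vanishes only on `ℤθ_Z`.
[cite: KaniCurvesGenus2AbelianSurfaces, §2 (11) (chunk p0005)] [cite: Kani1994EllipticCurvesAbelianSurfaces] [cite: BirkenhakeWilhelm2003, §4 Prop. 4.7 (p. 1830)] -/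
theorem humbertInvariant_humbertVectorOfGram_nonneg_of_isNSForm {η : (Fin 2 → ℂ) [⋀^Fin 2]→L[ℝ] ℝ}
    (hη : IsNSForm (prinPeriod Z) η) :
    0 ≤ humbertInvariant (humbertVectorOfGram (latticeGram (prinPeriod Z) η)) ∧
      (humbertInvariant (humbertVectorOfGram (latticeGram (prinPeriod Z) η)) = 0 ↔ ∃ m : ℤ, η = m • prinForm Z) := by
  rw [← refinedHumbert_prinForm_eq_humbertInvariant]
  exact ⟨(isPrincipalPolarization_prinForm Z).refinedHumbert_nonneg (prinPeriod Z) stdIdx hη.type_one_one,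
    (isPrincipalPolarization_prinForm Z).refinedHumbert_eq_zero_iff_exists_int (prinPeriod Z) stdIdx hη⟩

/-! ## §5 Elliptic curves on `X_Z`: `q̃_{θ_Z}([Y]) = (deg Y)²` and `Z ∈ H_{(deg Y)²}`; the diagonal -/

/-- **`q̃_{θ_Z}([Y]) = (deg_{θ_Z} Y)²` for an elliptic curve `Y ⊂ X_Z`** (Auffarth Rem. 3.2, `n = 2`; Kani): with
`[Y] = D_ℂ`, `[Y] ∧ [Y] = 0` (p36 `SubtorusFrame.cycleForm_wedge_self_eq_zero`) and
`(D·θ_Z) = ∫_X E_{Z,ℂ} ∧ [Y] = E_Z(Φλ′₀, Φλ′₁)` (A4-61 `SubtorusFrame.torusIntegral_ofRealForm_wedge_cycleForm`), so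
`q̃(D) = E_Z(Φλ′₀, Φλ′₁)² = (deg Y)²` (`deg Y = −E_Z(Φλ′₀, Φλ′₁)`, `c₁ = −E_Z`).
[cite: Auffarth2015EllipticCurvesAbelianVarieties, §3 Remark 3.2 (p0007 L27)] [cite: Kani1994EllipticCurvesAbelianSurfaces] [cite: KaniCurvesGenus2AbelianSurfaces, §2 (11) (chunk p0005)] -/
theorem refinedHumbert_prinForm_eq_degree_sq (Y : SubtorusFrame (prinPeriod Z) 2) {η : (Fin 2 → ℂ) [⋀^Fin 2]→L[ℝ] ℝ}
    (hη : ofRealForm η = Y.cycleForm stdIdx) :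
    refinedHumbert (prinPeriod Z) stdIdx (prinForm Z) η =
      (prinForm Z ![latticeVec (prinPeriod Z) (Y.frame 0), latticeVec (prinPeriod Z) (Y.frame 1)]) ^ 2 := by
  have hsq : (ComplexTorus.torusIntegral (prinPeriod Z) stdIdx ((ofRealForm η).wedge (ofRealForm η))).re = 0 := by
    rw [hη, Y.cycleForm_wedge_self_eq_zero (prinPeriod Z) stdIdx (by norm_num), ComplexTorus.torusIntegral_zero,
      Complex.zero_re]
  have hdeg : (ComplexTorus.torusIntegral (prinPeriod Z) stdIdx ((ofRealForm η).wedge (ofRealForm (prinForm Z)))).re =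
      prinForm Z ![latticeVec (prinPeriod Z) (Y.frame 0), latticeVec (prinPeriod Z) (Y.frame 1)] := by
    rw [wedge_comm_two_two_complex, hη, Y.torusIntegral_ofRealForm_wedge_cycleForm (prinPeriod Z) stdIdx (prinForm Z),
      Complex.ofReal_re]
  rw [refinedHumbert_prinForm_unfold, hsq, hdeg]
  ring

/-- **An elliptic curve `Y ⊂ X_Z` of degree `δ`: its class `D = [Y] ∈ NS(X_Z)` has `q̃_{θ_Z}(D) = δ²`, `δ > 0`, and
`Z ∈ H_{δ²}(𝔥₂)`** (Kani 1994 / B–W Prop. 4.8, degree clause, with the refined Humbert value made explicit; the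
class is Néron–Severi by the integral Lefschetz `(1,1)` theorem, row A4-23 `mem_integralHodgeClasses_one_iff_exists`).
[cite: Kani1994EllipticCurvesAbelianSurfaces] [cite: Auffarth2015EllipticCurvesAbelianVarieties, Thm. 1.2 (`n = 2`) and Remark 3.2] [cite: BirkenhakeWilhelm2003, §4 Prop. 4.8 and its proof (p. 1830)] -/
theorem exists_isNSForm_refinedHumbert_eq_degree_sq (Y : SubtorusFrame (prinPeriod Z) 2) :
    ∃ (η : (Fin 2 → ℂ) [⋀^Fin 2]→L[ℝ] ℝ) (δ : ℤ), IsNSForm (prinPeriod Z) η ∧ ofRealForm η = Y.cycleForm stdIdx ∧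
      0 < δ ∧ (δ : ℝ) = -prinForm Z ![latticeVec (prinPeriod Z) (Y.frame 0), latticeVec (prinPeriod Z) (Y.frame 1)] ∧
      refinedHumbert (prinPeriod Z) stdIdx (prinForm Z) η = (δ : ℝ) ^ 2 ∧ Z ∈ humbertLocusOfInvariant (δ ^ 2) := by
  have hγI : Y.cycleForm stdIdx ∈ integralHodgeClasses (prinPeriod Z) 1 :=
    (mem_integralHodgeClasses_iff (prinPeriod Z)).2
      ⟨Y.cycleForm_mem_integralForms _,
        ((mem_hodgeClasses_iff (prinPeriod Z)).1 (Y.cycleForm_mem_hodgeClasses (p := 1) _)).2⟩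
  obtain ⟨η, hηNS, hηγ⟩ := (mem_integralHodgeClasses_one_iff_exists (prinPeriod Z)).1 hγI
  obtain ⟨δ, hδ, hδeq, hZ⟩ := mem_humbertLocusOfInvariant_degree_sq Z Y
  refine ⟨η, δ, (mem_neronSeveriGroup_iff (prinPeriod Z)).1 hηNS, hηγ, hδ, hδeq, ?_, hZ⟩
  rw [refinedHumbert_prinForm_eq_degree_sq Z Y hηγ, hδeq, neg_sq]

/-- **Validation on the diagonal**: if `z₁₂ = 0` (`X_Z = E_{z₁₁} × E_{z₂₂}`), then `q_{(X_Z,θ_Z)}` represents `1`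
(row A4-60: `Z ∈ H_{(0,1,0,0,0)} ⊂ H_1(𝔥₂)`; the class is that of a fibre `E_{z₁₁} × {pt}`, of degree `1`).
[cite: BirkenhakeWilhelm2003, §4 Prop. 4.8 (p. 1830: "`H_1` … products of elliptic curves")] [cite: KaniCurvesGenus2AbelianSurfaces, §2 (11) (chunk p0005)] -/
theorem exists_isNSForm_refinedHumbert_eq_one_of_apply_eq_zero (h : (Z : Matrix (Fin 2) (Fin 2) ℂ) 0 1 = 0) :
    ∃ η : (Fin 2 → ℂ) [⋀^Fin 2]→L[ℝ] ℝ, IsNSForm (prinPeriod Z) η ∧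
      refinedHumbert (prinPeriod Z) stdIdx (prinForm Z) η = 1 := by
  have h1 := (mem_humbertLocusOfInvariant_iff_exists_isNSForm_refinedHumbert_eq Z one_ne_zero).1
    (mem_humbertLocusOfInvariant_one_of_apply_eq_zero Z h)
  simpa using h1

end SiegelModuli

end Literature.AlgebraicGeometry.ModuliOfAbelianVarieties

end
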